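import Summits.AtomisticToContinuum.HydrodynamicLimit.Theorems.MourreKoopmanChargesLinearToEntropyInBandWindowClauseCovering
import HarnessLib

/-!
# Route `MourreKoopmanCharges`, crux `LinearToEntropyInBand` (stmt-AtomisticToContinuum-17740), skeleton v8:
# stub 4a-ii, quasi-static smoothed slow fields — the deterministic two-configuration estimate (plan § 1 (3) D1, § 3)

Support file (`--supports stmt-AtomisticToContinuum-17740`; registered helper `stub_windowClauseQuasiStatic`; worker of lead
prover-line-…-17740-c6-0, wave 1; plan `WINDOWCLAUSE-PLAN.md` § 1 (3) D1 last lines, § 3 "quasi-static smoothed slow fields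
along good orbits").

The cone-smoothed VISIBLE block fields `ρ̄ = visDensityN`, `m̄ = visMomentumN`, `ē = visEnergyN` (DefsB (e); cone radius `kν`,
`ν = (N+1)^{-1/3}`, peak `P = 3/(π (kν)³)`) are compared at TWO configurations `y, y'` of the `N + 1` particles and one
point `x` (§ 2).  Two mechanisms, both visible in the bounds:
* COMMON-VISIBLE particles (visible in `y` and in `y'`) pay Lipschitz × displacement, `P d(yᵢ, y'ᵢ)/(kν)` — and only those
  within the cone support of `x` in one of the two configurations (§ 1: `cone k N x ·` is `P/(kν)`-Lipschitz for the
  minimal-image distance and vanishes outside the radius `kν`); for `m̄`, `ē` also the velocity change, `P ‖vᵢ − v'ᵢ‖`,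
  `P |‖vᵢ‖²/2 − ‖v'ᵢ‖²/2|`;
* FLIPPED particles (visible in exactly one of `y, y'`) pay one peak each (`P`, `P(K+U)`, `P(K+U)²/2`; `‖us‖_∞ ≤ U`).
An arbitrary exceptional index set `E` (e.g. the particles that collide between two times) is moved from the first
mechanism to the crude bound `2 ×` peak; one normed-space lemma (`norm_ite_smul_sub_ite_smul_le`) serves all three fields.
§ 3 is the FREE-FLIGHT corollary: if the non-exceptional common-visible particles fly freely, `y'ᵢ = (xᵢ + proj(t vᵢ), vᵢ)`,
their displacement is `≤ (K+U)|t|` (`‖vᵢ − us(xᵢ)‖ ≤ K`); for `(K+U)|t| ≤ kν` they are visible particles within `2kν` of `x`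
in `y`, at most `(N+1) π ν³ (16k + R)³ ρmax` of them by the covering machinery of `…WindowClauseCovering`
(`card_visible_near_le`, the count form of `visDensityN_le_geometric`), whence
`|ρ̄(y, x) − ρ̄(y', x)| ≤ 3 (16 + R/k)³ ρmax (K+U)|t|/(kν) + (N+1)⁻¹ P (#flips + 2 #E)`.
Deterministic, every pair of configurations, every `x`; nothing restates the crux, a stub, a neighbour's stub or the Statement.
References: C. Kipnis, C. Landim, *Scaling Limits of Interacting Particle Systems* (1999) Ch. 5 (block averages, cut-offs);
H. Spohn, *Large Scale Dynamics of Interacting Particles* (1991) Part I § 3.3.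
-/

noncomputable section

open MeasureTheory Filter Set Metric
open scoped ENNReal Topology InnerProductSpace BigOperators

namespace Summit.AtomisticToContinuum.HydrodynamicLimit.Theorems.LTEInBand

open Literature.MathematicalPhysics.KineticTheory Literature.Analysis.FluidPDE Literature.Analysis.FunctionSpaces
open Summit.AtomisticToContinuum.HydrodynamicLimit.Theorems.ShearStressHalfDrudeFrozenGlueHelpers (dist_le_euclidDist)

/-! ## § 1 The cone kernel is Lipschitz in its second argument -/

section ConeLipschitz

variable {N : ℕ} {k : ℝ}

/-- **(a) The cone kernel is Lipschitz in its second argument**: for `0 < kν`,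
`|cone k N x y − cone k N x y'| ≤ 3/(π (kν)³) · d(y, y')/(kν)` (`|max 0 a − max 0 b| ≤ |a − b|` and the `1`-Lipschitz
continuity of the minimal-image distance `d(x, ·)`, by the triangle inequality `torus_euclidDist_triangle`). -/
theorem abs_cone_sub_cone_le (hk : 0 < k * ((N : ℝ) + 1) ^ (-(1 / 3 : ℝ))) (x y y' : T3) :
    |cone k N x y - cone k N x y'| ≤
      3 / (Real.pi * (k * ((N : ℝ) + 1) ^ (-(1 / 3 : ℝ))) ^ 3) * (Torus.euclidDist y y' / (k * ((N : ℝ) + 1) ^ (-(1 / 3 : ℝ)))) := by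
  set r : ℝ := k * ((N : ℝ) + 1) ^ (-(1 / 3 : ℝ)) with hr
  have hP : 0 ≤ 3 / (Real.pi * r ^ 3) := by positivity
  have hd : |Torus.euclidDist x y' - Torus.euclidDist x y| ≤ Torus.euclidDist y y' := by
    rw [abs_sub_le_iff]
    constructor <;>
      linarith [torus_euclidDist_triangle x y y', torus_euclidDist_triangle x y' y, Torus.euclidDist_comm y' y]
  unfold cone
  rw [← mul_sub, abs_mul, abs_of_nonneg hP]
  refine mul_le_mul_of_nonneg_left ?_ hP
  rw [max_comm (0 : ℝ), max_comm (0 : ℝ)]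
  refine (abs_max_sub_max_le_abs _ _ _).trans ?_
  rw [show (1 - Torus.euclidDist x y / r) - (1 - Torus.euclidDist x y' / r) =
      (Torus.euclidDist x y' - Torus.euclidDist x y) / r by ring, abs_div, abs_of_pos hk]
  exact div_le_div_of_nonneg_right hd hk.le

/-- Outside the cone support of `x` in BOTH positions the cone kernel vanishes at both. -/
theorem cone_eq_zero_of_not_near (hk : 0 < k * ((N : ℝ) + 1) ^ (-(1 / 3 : ℝ))) {x y y' : T3}
    (h : ¬(Torus.euclidDist x y < k * ((N : ℝ) + 1) ^ (-(1 / 3 : ℝ)) ∨ Torus.euclidDist x y' < k * ((N : ℝ) + 1) ^ (-(1 / 3 : ℝ)))) :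
    cone k N x y = 0 ∧ cone k N x y' = 0 :=
  ⟨cone_eq_zero_of_le hk (not_lt.1 (not_or.1 h).1), cone_eq_zero_of_le hk (not_lt.1 (not_or.1 h).2)⟩

end ConeLipschitz

/-! ## § 2 The two-configuration estimate of the visible block fields -/

section TwoConfig

variable {N : ℕ} {ρs : T3 → ℝ} {us : T3 → V3} {R K k : ℝ}

/-- **The per-particle mechanism, once for all three fields.**  Weights `c, c' ∈ [0, M]` with `|c − c'| ≤ L` and
`c = c' = 0` unless "near" (`q`); payloads `w, w'` of norm `≤ W` when visible (`p`, `p'`); exceptional flag `e`.  Then the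
visible summand `𝟙[p] c • w` changes by at most: `L W + M ‖w − w'‖` if common-visible, near and not exceptional; `M W` if
the visibility flips; `2 M W` if exceptional. -/
theorem norm_ite_smul_sub_ite_smul_le {V : Type*} [SeminormedAddCommGroup V] [NormedSpace ℝ V] {p p' q e : Prop}
    [Decidable p] [Decidable p'] [Decidable q] [Decidable e] {c c' M L W : ℝ} {w w' : V} (hc : 0 ≤ c) (hc' : 0 ≤ c')
    (hcM : c ≤ M) (hc'M : c' ≤ M) (hW : p → ‖w‖ ≤ W) (hW' : p' → ‖w'‖ ≤ W) (hW0 : 0 ≤ W) (hlip : |c - c'| ≤ L)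
    (hfar : ¬q → c = 0 ∧ c' = 0) :
    ‖(if p then c • w else 0) - (if p' then c' • w' else 0)‖ ≤
      (if (p ∧ p' ∧ q) ∧ ¬e then L * W + M * ‖w - w'‖ else 0) + (if ¬(p ↔ p') then M * W else 0) +
        (if e then 2 * (M * W) else 0) := by
  have hM : 0 ≤ M := hc.trans hcM
  have hL : 0 ≤ L := (abs_nonneg _).trans hlip
  have h1 : p → ‖c • w‖ ≤ M * W := fun hp => by
    rw [norm_smul, Real.norm_of_nonneg hc]; exact mul_le_mul hcM (hW hp) (norm_nonneg _) hM
  have h1' : p' → ‖c' • w'‖ ≤ M * W := fun hp => by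
    rw [norm_smul, Real.norm_of_nonneg hc']; exact mul_le_mul hc'M (hW' hp) (norm_nonneg _) hM
  by_cases hp : p <;> by_cases hp' : p'
  · have hF : ¬¬(p ↔ p') := not_not.2 (iff_of_true hp hp')
    rw [if_pos hp, if_pos hp', if_neg hF, add_zero]
    by_cases he : e
    · rw [if_pos he, if_neg fun h => h.2 he, zero_add, two_mul]
      exact (norm_sub_le _ _).trans (add_le_add (h1 hp) (h1' hp'))
    · rw [if_neg he, add_zero]
      by_cases hq : q
      · rw [if_pos ⟨⟨hp, hp', hq⟩, he⟩,
          show c • w - c' • w' = (c - c') • w + c' • (w - w') by rw [sub_smul, smul_sub]; abel]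
        refine (norm_add_le _ _).trans (add_le_add ?_ ?_)
        · rw [norm_smul, Real.norm_eq_abs]
          exact mul_le_mul hlip (hW hp) (norm_nonneg _) hL
        · rw [norm_smul, Real.norm_of_nonneg hc']
          exact mul_le_mul_of_nonneg_right hc'M (norm_nonneg _)
      · obtain ⟨h0, h0'⟩ := hfar hq
        rw [if_neg fun h => hq h.1.2.2, h0, h0', zero_smul, zero_smul, sub_zero, norm_zero]
  · have hF : ¬(p ↔ p') := fun h => hp' (h.1 hp)
    rw [if_pos hp, if_neg hp', if_pos hF, if_neg fun h => hp' h.1.2.1, sub_zero, zero_add]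
    exact le_add_of_le_of_nonneg (h1 hp) (by split_ifs <;> positivity)
  · have hF : ¬(p ↔ p') := fun h => hp (h.2 hp')
    rw [if_neg hp, if_pos hp', if_pos hF, if_neg fun h => hp h.1.1, zero_sub, norm_neg, zero_add]
    exact le_add_of_le_of_nonneg (h1' hp') (by split_ifs <;> positivity)
  · rw [if_neg hp, if_neg hp', if_neg fun h => hp h.1.1, sub_zero, norm_zero, zero_add]
    exact add_nonneg (by split_ifs <;> positivity) (by split_ifs <;> positivity)

/-- Bookkeeping: the sum of the three per-particle indicator bounds. -/
theorem sum_three_indicators (A F : Fin (N + 1) → Prop) [DecidablePred A] [DecidablePred F] (E : Finset (Fin (N + 1)))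
    (f : Fin (N + 1) → ℝ) (C C₂ : ℝ) :
    ∑ i, ((if A i ∧ i ∉ E then f i else 0) + (if F i then C else 0) + (if i ∈ E then C₂ else 0)) =
      ∑ i ∈ (Finset.univ.filter A) \ E, f i + C * ((Finset.univ.filter F).card : ℝ) + C₂ * (E.card : ℝ) := by
  rw [Finset.sum_add_distrib, Finset.sum_add_distrib]
  congr 2
  · rw [← Finset.sum_filter]
    refine Finset.sum_congr ?_ fun _ _ => rfl
    ext i
    simp only [Finset.mem_filter, Finset.mem_univ, true_and, Finset.mem_sdiff]
  · rw [← Finset.sum_filter, Finset.sum_const, nsmul_eq_mul, mul_comm]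
  · rw [Finset.sum_ite_mem, Finset.univ_inter, Finset.sum_const, nsmul_eq_mul, mul_comm]

/-- Bookkeeping: the constants of the Lipschitz sum, `Σ_S c (gᵢ/a) b = c a⁻¹ b Σ_S gᵢ`. -/
theorem sum_mul_div_mul (S : Finset (Fin (N + 1))) (c a b : ℝ) (g : Fin (N + 1) → ℝ) :
    ∑ i ∈ S, c * (g i / a) * b = c * a⁻¹ * b * ∑ i ∈ S, g i := by
  rw [Finset.mul_sum]
  exact Finset.sum_congr rfl fun i _ => by ring

/-- **(b) Two-configuration estimate of the visible block DENSITY.**  For `0 < kν` (peak `P = 3/(π(kν)³)`), two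
configurations `y, y'`, a point `x` and any exceptional index set `E`:
`|ρ̄(y, x) − ρ̄(y', x)| ≤ (N+1)⁻¹ [P (kν)⁻¹ Σ' d(yᵢ, y'ᵢ) + P (#flips + 2 #E)]`, `Σ'` over the non-exceptional COMMON-VISIBLE
particles within the cone support of `x` in `y` or in `y'` (Lipschitz × displacement),
`#flips = #{i : VisibleN y i ↮ VisibleN y' i}` (one peak per flipped particle). -/
theorem abs_visDensityN_sub_le (hk : 0 < k * ((N : ℝ) + 1) ^ (-(1 / 3 : ℝ))) (y y' : Config (N + 1) (Fin 3) T3) (x : T3)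
    (E : Finset (Fin (N + 1))) :
    |visDensityN ρs us R K k N y x - visDensityN ρs us R K k N y' x| ≤
      ((N : ℝ) + 1)⁻¹ *
        (3 / (Real.pi * (k * ((N : ℝ) + 1) ^ (-(1 / 3 : ℝ))) ^ 3) * (k * ((N : ℝ) + 1) ^ (-(1 / 3 : ℝ)))⁻¹ *
            ∑ i ∈ (Finset.univ.filter fun i => VisibleN ρs us R K N y i ∧ VisibleN ρs us R K N y' i ∧
                (Torus.euclidDist x (y i).1 < k * ((N : ℝ) + 1) ^ (-(1 / 3 : ℝ)) ∨
                  Torus.euclidDist x (y' i).1 < k * ((N : ℝ) + 1) ^ (-(1 / 3 : ℝ)))) \ E,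
              Torus.euclidDist (y i).1 (y' i).1 +
          3 / (Real.pi * (k * ((N : ℝ) + 1) ^ (-(1 / 3 : ℝ))) ^ 3) *
            (((Finset.univ.filter fun i => ¬(VisibleN ρs us R K N y i ↔ VisibleN ρs us R K N y' i)).card : ℝ) +
              2 * (E.card : ℝ))) := by
  have hk0 : 0 ≤ k := le_of_lt (pos_of_mul_pos_left hk (by positivity))
  have hN : (0 : ℝ) < (N : ℝ) + 1 := by positivity
  have hsum : ∀ z : Config (N + 1) (Fin 3) T3, ∑ i, (if VisibleN ρs us R K N z i then cone k N x (z i).1 else 0) =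
      ∑ i, (if VisibleN ρs us R K N z i then cone k N x (z i).1 • (1 : ℝ) else 0) :=
    fun z => Finset.sum_congr rfl fun i _ => by rw [smul_eq_mul, mul_one]
  unfold visDensityN
  rw [hsum y, hsum y', ← mul_sub, ← Finset.sum_sub_distrib, ← Real.norm_eq_abs, norm_mul, norm_inv,
    Real.norm_of_nonneg hN.le]
  refine mul_le_mul_of_nonneg_left ((norm_sum_le _ _).trans ((Finset.sum_le_sum fun i _ =>
    norm_ite_smul_sub_ite_smul_le (e := i ∈ E) (cone_nonneg N hk0 x _) (cone_nonneg N hk0 x _) (cone_le_peak' hk x _)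
      (cone_le_peak' hk x _) (fun _ => norm_one.le) (fun _ => norm_one.le) zero_le_one (abs_cone_sub_cone_le hk x _ _)
      (cone_eq_zero_of_not_near hk)).trans (le_of_eq ?_))) (by positivity)
  rw [sum_three_indicators, Finset.sum_add_distrib, sum_mul_div_mul]
  simp only [sub_self, norm_zero, mul_zero, Finset.sum_const_zero, add_zero, mul_one]
  ring

/-- **(c) Two-configuration estimate of the visible block MOMENTUM** (`‖us‖_∞ ≤ U`, `0 ≤ K + U`, `0 < kν`, peak `P`):
`‖m̄(y, x) − m̄(y', x)‖ ≤ (N+1)⁻¹ [P (kν)⁻¹ (K+U) Σ' d(yᵢ, y'ᵢ) + P Σ' ‖vᵢ − v'ᵢ‖ + P (K+U) (#flips + 2 #E)]`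
(`Σ'` as in `abs_visDensityN_sub_le`; the second sum is the velocity change of the common-visible particles). -/
theorem norm_visMomentumN_sub_le (hk : 0 < k * ((N : ℝ) + 1) ^ (-(1 / 3 : ℝ))) {U : ℝ} (hus : ∀ x, ‖us x‖ ≤ U) (hV : 0 ≤ K + U)
    (y y' : Config (N + 1) (Fin 3) T3) (x : T3) (E : Finset (Fin (N + 1))) :
    ‖visMomentumN ρs us R K k N y x - visMomentumN ρs us R K k N y' x‖ ≤
      ((N : ℝ) + 1)⁻¹ *
        (3 / (Real.pi * (k * ((N : ℝ) + 1) ^ (-(1 / 3 : ℝ))) ^ 3) * (k * ((N : ℝ) + 1) ^ (-(1 / 3 : ℝ)))⁻¹ * (K + U) *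
            ∑ i ∈ (Finset.univ.filter fun i => VisibleN ρs us R K N y i ∧ VisibleN ρs us R K N y' i ∧
                (Torus.euclidDist x (y i).1 < k * ((N : ℝ) + 1) ^ (-(1 / 3 : ℝ)) ∨
                  Torus.euclidDist x (y' i).1 < k * ((N : ℝ) + 1) ^ (-(1 / 3 : ℝ)))) \ E,
              Torus.euclidDist (y i).1 (y' i).1 +
          3 / (Real.pi * (k * ((N : ℝ) + 1) ^ (-(1 / 3 : ℝ))) ^ 3) *
            ∑ i ∈ (Finset.univ.filter fun i => VisibleN ρs us R K N y i ∧ VisibleN ρs us R K N y' i ∧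
                (Torus.euclidDist x (y i).1 < k * ((N : ℝ) + 1) ^ (-(1 / 3 : ℝ)) ∨
                  Torus.euclidDist x (y' i).1 < k * ((N : ℝ) + 1) ^ (-(1 / 3 : ℝ)))) \ E,
              ‖(y i).2 - (y' i).2‖ +
          3 / (Real.pi * (k * ((N : ℝ) + 1) ^ (-(1 / 3 : ℝ))) ^ 3) * (K + U) *
            (((Finset.univ.filter fun i => ¬(VisibleN ρs us R K N y i ↔ VisibleN ρs us R K N y' i)).card : ℝ) +
              2 * (E.card : ℝ))) := by
  have hk0 : 0 ≤ k := le_of_lt (pos_of_mul_pos_left hk (by positivity))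
  have hN : (0 : ℝ) < (N : ℝ) + 1 := by positivity
  unfold visMomentumN
  rw [← smul_sub, ← Finset.sum_sub_distrib, norm_smul, norm_inv, Real.norm_of_nonneg hN.le]
  refine mul_le_mul_of_nonneg_left ((norm_sum_le _ _).trans ((Finset.sum_le_sum fun i _ =>
    norm_ite_smul_sub_ite_smul_le (e := i ∈ E) (cone_nonneg N hk0 x _) (cone_nonneg N hk0 x _) (cone_le_peak' hk x _)
      (cone_le_peak' hk x _) (fun h => norm_vel_le_of_visibleN ρs R N hus h)
      (fun h => norm_vel_le_of_visibleN ρs R N hus h) hV (abs_cone_sub_cone_le hk x _ _)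
      (cone_eq_zero_of_not_near hk)).trans (le_of_eq ?_))) (by positivity)
  rw [sum_three_indicators, Finset.sum_add_distrib, sum_mul_div_mul, ← Finset.mul_sum]
  ring

/-- **(c) Two-configuration estimate of the visible block KINETIC ENERGY** (`‖us‖_∞ ≤ U`, `0 < kν`, peak
`P`): `|ē(y, x) − ē(y', x)| ≤ (N+1)⁻¹ [P (kν)⁻¹ ((K+U)²/2) Σ' d(yᵢ, y'ᵢ) + P Σ' |‖vᵢ‖²/2 − ‖v'ᵢ‖²/2| +
P ((K+U)²/2) (#flips + 2 #E)]`. -/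
theorem abs_visEnergyN_sub_le (hk : 0 < k * ((N : ℝ) + 1) ^ (-(1 / 3 : ℝ))) {U : ℝ} (hus : ∀ x, ‖us x‖ ≤ U)
    (y y' : Config (N + 1) (Fin 3) T3) (x : T3) (E : Finset (Fin (N + 1))) :
    |visEnergyN ρs us R K k N y x - visEnergyN ρs us R K k N y' x| ≤
      ((N : ℝ) + 1)⁻¹ *
        (3 / (Real.pi * (k * ((N : ℝ) + 1) ^ (-(1 / 3 : ℝ))) ^ 3) * (k * ((N : ℝ) + 1) ^ (-(1 / 3 : ℝ)))⁻¹ * ((K + U) ^ 2 / 2) *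
            ∑ i ∈ (Finset.univ.filter fun i => VisibleN ρs us R K N y i ∧ VisibleN ρs us R K N y' i ∧
                (Torus.euclidDist x (y i).1 < k * ((N : ℝ) + 1) ^ (-(1 / 3 : ℝ)) ∨
                  Torus.euclidDist x (y' i).1 < k * ((N : ℝ) + 1) ^ (-(1 / 3 : ℝ)))) \ E,
              Torus.euclidDist (y i).1 (y' i).1 +
          3 / (Real.pi * (k * ((N : ℝ) + 1) ^ (-(1 / 3 : ℝ))) ^ 3) *
            ∑ i ∈ (Finset.univ.filter fun i => VisibleN ρs us R K N y i ∧ VisibleN ρs us R K N y' i ∧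
                (Torus.euclidDist x (y i).1 < k * ((N : ℝ) + 1) ^ (-(1 / 3 : ℝ)) ∨
                  Torus.euclidDist x (y' i).1 < k * ((N : ℝ) + 1) ^ (-(1 / 3 : ℝ)))) \ E,
              |‖(y i).2‖ ^ 2 / 2 - ‖(y' i).2‖ ^ 2 / 2| +
          3 / (Real.pi * (k * ((N : ℝ) + 1) ^ (-(1 / 3 : ℝ))) ^ 3) * ((K + U) ^ 2 / 2) *
            (((Finset.univ.filter fun i => ¬(VisibleN ρs us R K N y i ↔ VisibleN ρs us R K N y' i)).card : ℝ) +
              2 * (E.card : ℝ))) := by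
  have hk0 : 0 ≤ k := le_of_lt (pos_of_mul_pos_left hk (by positivity))
  have hN : (0 : ℝ) < (N : ℝ) + 1 := by positivity
  have hsum : ∀ z : Config (N + 1) (Fin 3) T3,
      ∑ i, (if VisibleN ρs us R K N z i then cone k N x (z i).1 * ‖(z i).2‖ ^ 2 / 2 else 0) =
        ∑ i, (if VisibleN ρs us R K N z i then cone k N x (z i).1 • (‖(z i).2‖ ^ 2 / 2) else 0) :=
    fun z => Finset.sum_congr rfl fun i _ => by rw [smul_eq_mul, mul_div_assoc]
  have hW : ∀ {z : Config (N + 1) (Fin 3) T3} {i : Fin (N + 1)}, VisibleN ρs us R K N z i →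
      ‖‖(z i).2‖ ^ 2 / 2‖ ≤ (K + U) ^ 2 / 2 := fun h => by
    rw [Real.norm_of_nonneg (by positivity)]
    exact div_le_div_of_nonneg_right (pow_le_pow_left₀ (norm_nonneg _) (norm_vel_le_of_visibleN ρs R N hus h) 2)
      zero_le_two
  unfold visEnergyN
  rw [hsum y, hsum y', ← mul_sub, ← Finset.sum_sub_distrib, ← Real.norm_eq_abs, norm_mul, norm_inv,
    Real.norm_of_nonneg hN.le]
  refine mul_le_mul_of_nonneg_left ((norm_sum_le _ _).trans ((Finset.sum_le_sum fun i _ =>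
    norm_ite_smul_sub_ite_smul_le (e := i ∈ E) (cone_nonneg N hk0 x _) (cone_nonneg N hk0 x _) (cone_le_peak' hk x _)
      (cone_le_peak' hk x _) hW hW (by positivity) (abs_cone_sub_cone_le hk x _ _)
      (cone_eq_zero_of_not_near hk)).trans (le_of_eq ?_))) (by positivity)
  rw [sum_three_indicators, Finset.sum_add_distrib, sum_mul_div_mul, ← Finset.mul_sum]
  simp only [Real.norm_eq_abs]
  ring

/-! ## § 3 Free flight: displacement, the number of visible particles near a point, the quasi-static corollary -/

/-- **Free-flight displacement of a slow particle**: `d(x, x + proj(t v)) ≤ (K + U)|t|` if `‖v − us(x)‖ ≤ K`, `‖us‖_∞ ≤ U`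
(`euclidDist_add_proj_self_le`: a translate by `proj a` is at minimal-image distance `≤ ‖a‖`). -/
theorem euclidDist_add_proj_smul_le {U : ℝ} (hus : ∀ x, ‖us x‖ ≤ U) {x : T3} {v : V3} (hv : ‖v - us x‖ ≤ K) (t : ℝ) :
    Torus.euclidDist x (x + Torus.proj (t • v)) ≤ (K + U) * |t| := by
  rw [Torus.euclidDist_comm]
  refine (euclidDist_add_proj_self_le x (t • v)).trans ?_
  rw [norm_smul, Real.norm_eq_abs, mul_comm]
  refine mul_le_mul_of_nonneg_right ((norm_le_insert' v (us x)).trans ?_) (abs_nonneg t)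
  linarith [hus x]

/-- **The number of VISIBLE particles within `Lν` of a point** (minimal-image distance; `0 ≤ L`, `0 < R`, `Rν ≤ 4`,
`ρs ≤ ρmax`, `0 ≤ ρmax`) is at most `(N+1) π ν³ (8L + R)³ ρmax` — the count form of `visDensityN_le_geometric`: cover them by
the `Rν/4` sup-neighbourhoods of a maximal `Rν/4`-separated visible subset (`exists_separated_cover`), each holding
`≤ (N+1) π (Rν)³ ρmax` particles (`card_near_visible_le`), at most `((Lν + Rν/8)/(Rν/8))³` of them (`card_le_of_separated`). -/
theorem card_visible_near_le {L ρmax : ℝ} (hR : 0 < R) (hL : 0 ≤ L) (hRν : R * ((N : ℝ) + 1) ^ (-(1 / 3 : ℝ)) ≤ 4)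
    (hρmax : 0 ≤ ρmax) (hρs : ∀ y, ρs y ≤ ρmax) (z : Config (N + 1) (Fin 3) T3) (x : T3) :
    ((Finset.univ.filter fun i =>
        VisibleN ρs us R K N z i ∧ Torus.euclidDist x (z i).1 ≤ L * ((N : ℝ) + 1) ^ (-(1 / 3 : ℝ))).card : ℝ) ≤
      ((N : ℝ) + 1) * (Real.pi * (((N : ℝ) + 1) ^ (-(1 / 3 : ℝ))) ^ 3) * (8 * L + R) ^ 3 * ρmax := by
  set ν : ℝ := ((N : ℝ) + 1) ^ (-(1 / 3 : ℝ)) with hν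
  have hν0 : 0 < ν := Real.rpow_pos_of_pos (by positivity) _
  have hr : 0 < R * ν := mul_pos hR hν0
  have ha : 0 < R * ν / 8 := by positivity
  have ha1 : 2 * (R * ν / 8) ≤ 1 := by linarith
  set W := Finset.univ.filter fun i => VisibleN ρs us R K N z i ∧ Torus.euclidDist x (z i).1 ≤ L * ν with hW
  obtain ⟨T, hTW, hsep, hcov⟩ := exists_separated_cover z ha W
  have hTvis : ∀ p ∈ T, VisibleN ρs us R K N z p ∧ Torus.euclidDist x (z p).1 ≤ L * ν := fun p hp =>
    (Finset.mem_filter.1 (hTW hp)).2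
  have hB : (W.card : ℝ) ≤ (T.card : ℝ) * (((N : ℝ) + 1) * (Real.pi * (R * ν) ^ 3) * ρmax) := by
    set f : Fin (N + 1) → Finset (Fin (N + 1)) := fun p => Finset.univ.filter fun j => dist (z p).1 (z j).1 ≤ R * ν / 4
      with hf
    have hsubU : W ⊆ T.biUnion f := by
      intro i hi
      obtain ⟨p, hp, hd⟩ := hcov i hi
      refine Finset.mem_biUnion.2 ⟨p, hp, Finset.mem_filter.2 ⟨Finset.mem_univ _, ?_⟩⟩
      rw [dist_comm]; linarith
    calc (W.card : ℝ) ≤ ((T.biUnion f).card : ℝ) := by exact_mod_cast Finset.card_le_card hsubU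
      _ ≤ ∑ p ∈ T, ((f p).card : ℝ) := by exact_mod_cast Finset.card_biUnion_le
      _ ≤ ∑ p ∈ T, ((N : ℝ) + 1) * (Real.pi * (R * ν) ^ 3) * ρmax := by
          refine Finset.sum_le_sum fun p hp => (card_near_visible_le hr (hTvis p hp).1).trans ?_
          exact mul_le_mul_of_nonneg_left (hρs _) (by positivity)
      _ = (T.card : ℝ) * (((N : ℝ) + 1) * (Real.pi * (R * ν) ^ 3) * ρmax) := by rw [Finset.sum_const, nsmul_eq_mul]
  have hC : (T.card : ℝ) ≤ ((L * ν + R * ν / 8) / (R * ν / 8)) ^ 3 :=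
    card_le_of_separated z x ha ha1 (by positivity) T (fun p hp => (dist_le_euclidDist _ _).trans (hTvis p hp).2) hsep
  calc (W.card : ℝ) ≤ ((L * ν + R * ν / 8) / (R * ν / 8)) ^ 3 * (((N : ℝ) + 1) * (Real.pi * (R * ν) ^ 3) * ρmax) :=
        hB.trans (mul_le_mul_of_nonneg_right hC (by positivity))
    _ = ((N : ℝ) + 1) * (Real.pi * ν ^ 3) * (8 * L + R) ^ 3 * ρmax := by
        field_simp

/-- **(d) The quasi-static corollary for the density.**  Radii `0 < R`, `0 < k`, `Rν ≤ 4`; `ρs ≤ ρmax`, `0 ≤ ρmax`;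
`‖us‖_∞ ≤ U`, `0 ≤ K + U`; a time `t` with `(K + U)|t| ≤ kν`; two configurations `y, y'` such that every common-visible
particle outside the exceptional set `E` has flown freely, `y'ᵢ = (xᵢ + proj(t vᵢ), vᵢ)`.  Then at every `x`
`|ρ̄(y, x) − ρ̄(y', x)| ≤ 3 (16 + R/k)³ ρmax · (K+U)|t|/(kν) + (N+1)⁻¹ · 3/(π(kν)³) · (#flips + 2 #E)`:
the free-flying common-visible particles near `x` are visible and within `2kν` of `x` in `y` (`card_visible_near_le`
with `L = 2k`), each displaced by `≤ (K+U)|t|` (`euclidDist_add_proj_smul_le`). -/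
theorem abs_visDensityN_sub_le_of_freeFlight {U ρmax t : ℝ} (hR : 0 < R) (hk : 0 < k)
    (hRν : R * ((N : ℝ) + 1) ^ (-(1 / 3 : ℝ)) ≤ 4) (hρmax : 0 ≤ ρmax) (hρs : ∀ y, ρs y ≤ ρmax) (hus : ∀ x, ‖us x‖ ≤ U)
    (hV : 0 ≤ K + U) (ht : (K + U) * |t| ≤ k * ((N : ℝ) + 1) ^ (-(1 / 3 : ℝ))) (y y' : Config (N + 1) (Fin 3) T3)
    (E : Finset (Fin (N + 1)))
    (hfree : ∀ i, VisibleN ρs us R K N y i → VisibleN ρs us R K N y' i → i ∉ E →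
      y' i = ((y i).1 + Torus.proj (t • (y i).2), (y i).2)) (x : T3) :
    |visDensityN ρs us R K k N y x - visDensityN ρs us R K k N y' x| ≤
      3 * (16 + R / k) ^ 3 * ρmax * ((K + U) * |t| / (k * ((N : ℝ) + 1) ^ (-(1 / 3 : ℝ)))) +
        ((N : ℝ) + 1)⁻¹ * (3 / (Real.pi * (k * ((N : ℝ) + 1) ^ (-(1 / 3 : ℝ))) ^ 3)) *
          (((Finset.univ.filter fun i => ¬(VisibleN ρs us R K N y i ↔ VisibleN ρs us R K N y' i)).card : ℝ) +
            2 * (E.card : ℝ)) := by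
  have hν0 : 0 < ((N : ℝ) + 1) ^ (-(1 / 3 : ℝ)) := Real.rpow_pos_of_pos (by positivity) _
  have hr : 0 < k * ((N : ℝ) + 1) ^ (-(1 / 3 : ℝ)) := mul_pos hk hν0
  have h1 := abs_visDensityN_sub_le (ρs := ρs) (us := us) (R := R) (K := K) hr y y' x E
  have hcount := card_visible_near_le (us := us) (K := K) (L := 2 * k) hR (by positivity) hRν hρmax hρs y x
  set ν : ℝ := ((N : ℝ) + 1) ^ (-(1 / 3 : ℝ)) with hν
  set S := (Finset.univ.filter fun i => VisibleN ρs us R K N y i ∧ VisibleN ρs us R K N y' i ∧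
      (Torus.euclidDist x (y i).1 < k * ν ∨ Torus.euclidDist x (y' i).1 < k * ν)) \ E with hS
  have hmem : ∀ i ∈ S, VisibleN ρs us R K N y i ∧
      (Torus.euclidDist x (y i).1 < k * ν ∨ Torus.euclidDist x (y' i).1 < k * ν) ∧
        Torus.euclidDist (y i).1 (y' i).1 ≤ (K + U) * |t| := fun i hi => by
    obtain ⟨hA, hE⟩ := Finset.mem_sdiff.1 hi
    obtain ⟨hv, hv', hnear⟩ := (Finset.mem_filter.1 hA).2
    refine ⟨hv, hnear, ?_⟩
    rw [hfree i hv hv' hE]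
    exact euclidDist_add_proj_smul_le hus hv.1 t
  have hsub : S ⊆ Finset.univ.filter fun i => VisibleN ρs us R K N y i ∧ Torus.euclidDist x (y i).1 ≤ 2 * k * ν := by
    intro i hi
    obtain ⟨hv, hnear, hd⟩ := hmem i hi
    refine Finset.mem_filter.2 ⟨Finset.mem_univ _, hv, ?_⟩
    rcases hnear with h | h
    · linarith
    · linarith [torus_euclidDist_triangle x (y' i).1 (y i).1, Torus.euclidDist_comm (y' i).1 (y i).1]
  have hsum : ∑ i ∈ S, Torus.euclidDist (y i).1 (y' i).1 ≤
      ((N : ℝ) + 1) * (Real.pi * ν ^ 3) * (8 * (2 * k) + R) ^ 3 * ρmax * ((K + U) * |t|) :=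
    calc ∑ i ∈ S, Torus.euclidDist (y i).1 (y' i).1 ≤ ∑ i ∈ S, (K + U) * |t| :=
          Finset.sum_le_sum fun i hi => (hmem i hi).2.2
      _ = (S.card : ℝ) * ((K + U) * |t|) := by rw [Finset.sum_const, nsmul_eq_mul]
      _ ≤ ((N : ℝ) + 1) * (Real.pi * ν ^ 3) * (8 * (2 * k) + R) ^ 3 * ρmax * ((K + U) * |t|) :=
          mul_le_mul_of_nonneg_right ((by exact_mod_cast Finset.card_le_card hsub : (S.card : ℝ) ≤ _).trans hcount)
            (mul_nonneg hV (abs_nonneg t))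
  refine h1.trans ?_
  rw [mul_add]
  refine add_le_add ?_ (le_of_eq (by ring))
  calc _ ≤ ((N : ℝ) + 1)⁻¹ * (3 / (Real.pi * (k * ν) ^ 3) * (k * ν)⁻¹ *
        (((N : ℝ) + 1) * (Real.pi * ν ^ 3) * (8 * (2 * k) + R) ^ 3 * ρmax * ((K + U) * |t|))) := by gcongr
    _ = 3 * (16 + R / k) ^ 3 * ρmax * ((K + U) * |t| / (k * ν)) := by
        field_simp
        ring

end TwoConfig

/-! ## The registered helper stub -/

/-- **Registered helper stub `stub_windowClauseQuasiStatic` (plan § 1 (3) D1 / § 3 "quasi-static smoothed slow fields" of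
stub 4a-ii, skeleton v8, crux stmt-17740)**: sorry-free conjunction, with fully qualified names (the registered one-line
signature), of (a) the Lipschitz bound of the cone kernel `abs_cone_sub_cone_le` and, with the abbreviations `ν`, `P`
(peak), `S` (non-exceptional common-visible particles near `x`), `F` (flips) introduced as hypotheses, of (b) the
two-configuration estimate of the visible block density `abs_visDensityN_sub_le`, (c) its momentum and kinetic-energy
analogues `norm_visMomentumN_sub_le`, `abs_visEnergyN_sub_le`, (d) the quasi-static free-flight corollary
`abs_visDensityN_sub_le_of_freeFlight` and the count of visible particles near a point `card_visible_near_le`. -/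
theorem stub_windowClauseQuasiStatic : (∀ (N : ℕ) (k : ℝ), 0 < k * ((N : ℝ) + 1) ^ (-(1 / 3 : ℝ)) → ∀ (x y y' : Literature.MathematicalPhysics.KineticTheory.T3), |Summit.AtomisticToContinuum.HydrodynamicLimit.Theorems.LTEInBand.cone k N x y - Summit.AtomisticToContinuum.HydrodynamicLimit.Theorems.LTEInBand.cone k N x y'| ≤ 3 / (Real.pi * (k * ((N : ℝ) + 1) ^ (-(1 / 3 : ℝ))) ^ 3) * (Literature.Analysis.FluidPDE.Torus.euclidDist y y' / (k * ((N : ℝ) + 1) ^ (-(1 / 3 : ℝ))))) ∧ (∀ (N : ℕ) (ρs : Literature.MathematicalPhysics.KineticTheory.T3 → ℝ) (us : Literature.MathematicalPhysics.KineticTheory.T3 → Literature.MathematicalPhysics.KineticTheory.V3) (R K k U ρmax t ν P : ℝ) (y y' : Literature.Analysis.FluidPDE.Config (N + 1) (Fin 3) Literature.MathematicalPhysics.KineticTheory.T3) (x : Literature.MathematicalPhysics.KineticTheory.T3) (E S F : Finset (Fin (N + 1))), ν = ((N : ℝ) + 1) ^ (-(1 / 3 : ℝ)) → P = 3 / (Real.pi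 * (k * ν) ^ 3) → S = (Finset.univ.filter fun i => Summit.AtomisticToContinuum.HydrodynamicLimit.Theorems.LTEInBand.VisibleN ρs us R K N y i ∧ Summit.AtomisticToContinuum.HydrodynamicLimit.Theorems.LTEInBand.VisibleN ρs us R K N y' i ∧ (Literature.Analysis.FluidPDE.Torus.euclidDist x (y i).1 < k * ν ∨ Literature.Analysis.FluidPDE.Torus.euclidDist x (y' i).1 < k * ν)) \ E → F = (Finset.univ.filter fun i => ¬(Summit.AtomisticToContinuum.HydrodynamicLimit.Theorems.LTEInBand.VisibleN ρs us R K N y i ↔ Summit.AtomisticToContinuum.HydrodynamicLimit.Theorems.LTEInBand.VisibleN ρs us R K N y' i)) → 0 < k → (∀ x, ‖us x‖ ≤ U) → 0 ≤ K + U → |Summit.AtomisticToContinuum.HydrodynamicLimit.Theorems.LTEInBand.visDensityN ρs us R K k N y x - Summit.AtomisticToContinuum.HydrodynamicLimit.Theorems.LTEInBand.visDensityN ρs us R K k N y' x| ≤ ((N : ℝ) + 1)⁻¹ * (P * (k * ν)⁻¹ * ∑ i ∈ S, Literature.Analysis.FluidPDE.Torus.euclidDist (y i).1 (y' i).1 +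 P * ((F.card : ℝ) + 2 * (E.card : ℝ))) ∧ ‖Summit.AtomisticToContinuum.HydrodynamicLimit.Theorems.LTEInBand.visMomentumN ρs us R K k N y x - Summit.AtomisticToContinuum.HydrodynamicLimit.Theorems.LTEInBand.visMomentumN ρs us R K k N y' x‖ ≤ ((N : ℝ) + 1)⁻¹ * (P * (k * ν)⁻¹ * (K + U) * ∑ i ∈ S, Literature.Analysis.FluidPDE.Torus.euclidDist (y i).1 (y' i).1 + P * ∑ i ∈ S, ‖(y i).2 - (y' i).2‖ + P * (K + U) * ((F.card : ℝ) + 2 * (E.card : ℝ))) ∧ |Summit.AtomisticToContinuum.HydrodynamicLimit.Theorems.LTEInBand.visEnergyN ρs us R K k N y x - Summit.AtomisticToContinuum.HydrodynamicLimit.Theorems.LTEInBand.visEnergyN ρs us R K k N y' x| ≤ ((N : ℝ) + 1)⁻¹ * (P * (k * ν)⁻¹ * ((K + U) ^ 2 / 2) * ∑ i ∈ S, Literature.Analysis.FluidPDE.Torus.euclidDist (y i).1 (y' i).1 + P * ∑ i ∈ S, |‖(y i).2‖ ^ 2 / 2 - ‖(y' i).2‖ ^ 2 / 2| + P * ((K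 + U) ^ 2 / 2) * ((F.card : ℝ) + 2 * (E.card : ℝ))) ∧ (0 < R → R * ν ≤ 4 → 0 ≤ ρmax → (∀ y, ρs y ≤ ρmax) → (K + U) * |t| ≤ k * ν → (∀ i, Summit.AtomisticToContinuum.HydrodynamicLimit.Theorems.LTEInBand.VisibleN ρs us R K N y i → Summit.AtomisticToContinuum.HydrodynamicLimit.Theorems.LTEInBand.VisibleN ρs us R K N y' i → i ∉ E → y' i = ((y i).1 + Literature.Analysis.FunctionSpaces.Torus.proj (t • (y i).2), (y i).2)) → |Summit.AtomisticToContinuum.HydrodynamicLimit.Theorems.LTEInBand.visDensityN ρs us R K k N y x - Summit.AtomisticToContinuum.HydrodynamicLimit.Theorems.LTEInBand.visDensityN ρs us R K k N y' x| ≤ 3 * (16 + R / k) ^ 3 * ρmax * ((K + U) * |t| / (k * ν)) + ((N : ℝ) + 1)⁻¹ * P * ((F.card : ℝ) + 2 * (E.card : ℝ))) ∧ (∀ (L : ℝ) (z : Literature.Analysis.FluidPDE.Config (N + 1) (Fin 3) Literature.MathematicalPhysics.KineticTheory.T3) (x : Literature.MathematicalPhysics.KineticTheory.T3), 0 < R →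 0 ≤ L → R * ν ≤ 4 → 0 ≤ ρmax → (∀ y, ρs y ≤ ρmax) → ((Finset.univ.filter fun i => Summit.AtomisticToContinuum.HydrodynamicLimit.Theorems.LTEInBand.VisibleN ρs us R K N z i ∧ Literature.Analysis.FluidPDE.Torus.euclidDist x (z i).1 ≤ L * ν).card : ℝ) ≤ ((N : ℝ) + 1) * (Real.pi * ν ^ 3) * (8 * L + R) ^ 3 * ρmax)) :=
  ⟨fun _ _ hk x y y' => abs_cone_sub_cone_le hk x y y',
    fun N ρs us R K k U ρmax t ν P y y' x E S F hν hP hS hF hk hus hV => by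
      subst hν hP hS hF
      have hr : 0 < k * ((N : ℝ) + 1) ^ (-(1 / 3 : ℝ)) := mul_pos hk (Real.rpow_pos_of_pos (by positivity) _)
      exact ⟨abs_visDensityN_sub_le hr y y' x E, norm_visMomentumN_sub_le hr hus hV y y' x E,
        abs_visEnergyN_sub_le hr hus y y' x E, fun hR hRν hρmax hρs ht hfree =>
          abs_visDensityN_sub_le_of_freeFlight hR hk hRν hρmax hρs hus hV ht y y' E hfree x,
        fun L z x' hR hL hRν hρmax hρs => card_visible_near_le hR hL hRν hρmax hρs z x'⟩⟩

end Summit.AtomisticToContinuum.HydrodynamicLimit.Theorems.LTEInBand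

end
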